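import Literature.NumberTheory.Sieve.MoebiusShiftedPrimesProofs
import HarnessLib

/-!
# Hardy–Littlewood–Chowla on average (Lichtman–Teräväinen 2022): the Fourier-analytic argument

Topic `Literature/NumberTheory/Sieve`, companion of `HardyLittlewoodChowla.lean` (the named facts
`lichtmanTeravainen2022_hlc_avg`, `lichtmanTeravainen2022_hlc_avg_liouville` = J. D. Lichtman,
J. Teräväinen, *On the Hardy–Littlewood–Chowla conjecture on average*, Forum Math. Sigma 10 (2022)
e57, doi:10.1017/fms.2022.54, arXiv:2111.08912 [LichtmanTeravainen2022], Theorem 1.2 (i)).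
Everything in this file is PROVED; it introduces no definition and no named fact.

This file is the first layer (bottom-up) of the discharge of those facts along the printed proof
(held copy `paper:arxiv-2111.08912`, §3 "A Fourier-analytic argument"): **Proposition 3.2** —
"Let `X ≥ H ≥ 2`, `C ≥ 1`, `p ≥ 2`, `η > 0`. Let `f` be supported on `[0, X]` and satisfy
`𝖧₂(X, H, η)` (`sup_α ∫₀^X |∑_{x ≤ n ≤ x+2H} f(n) e(αn)|² dx ≤ η H² X E_f(X)²`), and let `g` satisfy
`𝖧₁(X, H, C, p)` (`∫₀^X ∫₀¹ |∑_{x ≤ n ≤ x+2H} g(n) e(αn)|^p dα dx ≤ C H^{p-1} X E_g(X)^p`). Then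
`∑_{h ≤ H} |∑_{n ≤ X} f(n+h) g(n)| ≪ (ηC)^{1/p} H X E_{|f|+|f|²}(X) E_g(X)`" — in the DISCRETE form in
which the tree's inputs are available (integer window positions instead of `∫₀^X dx`, exactly as in
the tree's rendering of Lichtman 2020, Lemma 2.1, `Lichtman2020.fourier_bound`, of which this is the
Hölder refinement):

* `LichtmanTeravainen2022.holder_fourier_bound` — for `u, w : ℕ → ℂ` with `w` supported on `[1, X]`,
  windows `W_k = (k - 2H, k]`, `k ∈ [1, X + 2H]`, an even exponent `p = 2j ≥ 4`, a uniform bound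
  `∑_k |∑_{m ∈ W_k} u(m) e(mα)|² ≤ A₂` (all `α`; hypothesis `𝖧₂`) and a moment bound
  `∫₀¹ ∑_k |∑_{n ∈ W_k} w(n) e(-nα)|^{2j} dα ≤ A₁` (hypothesis `𝖧₁`):
  `H ∑_{h=1}^{H} |∑_{n=1}^{X} w(n) u(n+h)| ≤ A₂^{1/2j} H^{1/2} (2H ∑_{m ≤ X+2H} |u(m)|²)^{(j-1)/2j}
    ((X+2H)^{j-1} A₁)^{1/2j}`.
  With `A₂ = η H² X`, `∑|u|² ≤ X + 2H`, `A₁ = C H^{2j-1} X` this is `≪ (ηC)^{1/2j} H · HX`, i.e. the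
  printed conclusion (the roles of the printed `f`, `g` are played by `u`, `w`).

Proof as printed (§3): double counting `(2H - h) ∑_n w(n) u(n+h) = ∑_k C_k(h)` over the windows
(`Lichtman2020.sum_window_shift`), unimodular phases `c(h)`, the orthogonality relation
`∫₀¹ e(nα) dα = [n = 0]` turning `∑_h c(h) C_k(h)` into `∫₀¹ C₀(α) U_k(α) W_k(α) dα`, Cauchy–Schwarz in
`k`, the splitting `(∑_k |U_k|²)^{1/2} ≤ A₂^{1/p} (∑_k |U_k|²)^{1/q}` (`1/p + 1/q = 1/2`), Hölder with
exponents `(2, q, p)` in `α`, Parseval for `∫|C₀|² ≤ H` and `∫ ∑_k |U_k|² ≤ 2H ∑ |u|²`, and Jensen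
`(∑_k |W_k|²)^{j} ≤ #K^{j-1} ∑_k |W_k|^{2j}`.

## Faithfulness / design notes

* The `x`-integral of the paper is replaced by the sum over integer window positions `k` with the
  truncated windows `(k - 2H, k] ∩ ℕ_{>0}` for `k < 2H` (as in `Lichtman2020.fourier_bound`); this is
  what makes the double count `2H - h` exact for every `1 ≤ n ≤ X` without the printed support
  condition "f supported on `[0, X]`" (needed in print only because `∫₀^X` misses the windows to the
  left of `0`).  Only the shifts `1 ≤ h ≤ H` are kept (the phases `c(h)` vanish elsewhere), which
  improves the printed `I₁ ≤ 2H` to `≤ H`.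
* `p = 2j` is an even integer `≥ 4` (the paper takes `p = 2 + 2⌈ℓ/ε⌉`); the frequency of the `w`-sums
  is `-n`, the sign produced by the expansion (immaterial for the moment hypothesis).
* The normalisations `E_f`, `E_g` of the paper are not needed: they only rescale `η` and `C`.

## References

* J. D. Lichtman, J. Teräväinen, Forum Math. Sigma 10 (2022) e57, arXiv:2111.08912, §3,
  Definition 3.1 and Proposition 3.2 with its proof. [cite: LichtmanTeravainen2022, Proposition 3.2]
* J. D. Lichtman, Q. J. Math. 73 (2022), arXiv:2009.08969, Lemma 2.1 (the `p = 2` case; tree: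
  `Lichtman2020.fourier_bound`). [cite: Lichtman2020, Lemma 2.1]
-/

open Finset MeasureTheory
open scoped FourierTransform ComplexConjugate

namespace Literature.NumberTheory.Sieve.LichtmanTeravainen2022

open Literature.NumberTheory.Sieve.Lichtman2020 (continuous_fourierChar_mul norm_fourierChar
  integral_norm_sq_trigSum sum_window_shift sum_coeff_fourierChar_eq)

/-! ### Hölder's inequality on `[0, 1]` for continuous functions -/

/-- Hölder's inequality on the unit interval for continuous nonnegative functions and conjugate
exponents `1/p + 1/q = 1` (Mathlib's `integral_mul_le_Lp_mul_Lq_of_nonneg` on `volume|(0,1]`;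
continuity gives the `L^p` memberships). [folklore] -/
theorem holder_unitInterval {p q : ℝ} (hpq : p.HolderConjugate q) {f g : ℝ → ℝ}
    (hf : Continuous f) (hg : Continuous g) (hf0 : ∀ x, 0 ≤ f x) (hg0 : ∀ x, 0 ≤ g x) :
    ∫ x in (0:ℝ)..1, f x * g x ≤
      (∫ x in (0:ℝ)..1, f x ^ p) ^ (1 / p) * (∫ x in (0:ℝ)..1, g x ^ q) ^ (1 / q) := by
  simp only [intervalIntegral.integral_of_le zero_le_one]
  have hb : ∀ {φ : ℝ → ℝ}, Continuous φ → ∃ C, ∀ x ∈ Set.Icc (0:ℝ) 1, ‖φ x‖ ≤ C := fun hφ =>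
    isCompact_Icc.exists_bound_of_continuousOn hφ.continuousOn
  have hmem : ∀ {φ : ℝ → ℝ} (r : ℝ), Continuous φ →
      MemLp φ (ENNReal.ofReal r) (volume.restrict (Set.Ioc (0:ℝ) 1)) := by
    intro φ r hφ
    obtain ⟨C, hC⟩ := hb hφ
    refine MemLp.of_bound hφ.aestronglyMeasurable C ?_
    rw [ae_restrict_iff' measurableSet_Ioc]
    exact Filter.Eventually.of_forall fun x hx => hC x (Set.Ioc_subset_Icc_self hx)
  exact integral_mul_le_Lp_mul_Lq_of_nonneg hpq (Filter.Eventually.of_forall hf0)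
    (Filter.Eventually.of_forall hg0) (hmem p hf) (hmem q hg)

/-! ### Orthogonality -/

/-- `e(-hα) e(h'α) = e((h' - h)α)`. [folklore] -/
theorem fourierChar_neg_mul_mul (h h' : ℤ) (α : ℝ) :
    (𝐞 ((((-h : ℤ)) : ℝ) * α) : ℂ) * (𝐞 ((h' : ℝ) * α) : ℂ) =
      (𝐞 ((((h' - h : ℤ)) : ℝ) * α) : ℂ) := by
  rw [← Circle.coe_mul, ← AddChar.map_add_eq_mul]
  congr 2
  push_cast
  ring

/-- **Orthogonality for a product of two trigonometric polynomials**: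
`∫₀¹ (∑_{h ∈ T} a_h e(-hα)) (∑_{h' ∈ T} b_{h'} e(h'α)) dα = ∑_{h ∈ T} a_h b_h`. [folklore] -/
theorem integral_trigSum_mul_trigSum (T : Finset ℤ) (a b : ℤ → ℂ) :
    ∫ α in (0:ℝ)..1, (∑ h ∈ T, a h * (𝐞 ((((-h : ℤ)) : ℝ) * α) : ℂ)) *
        (∑ h' ∈ T, b h' * (𝐞 ((h' : ℝ) * α) : ℂ)) = ∑ h ∈ T, a h * b h := by
  have hexp : ∀ α : ℝ, (∑ h ∈ T, a h * (𝐞 ((((-h : ℤ)) : ℝ) * α) : ℂ)) *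
      (∑ h' ∈ T, b h' * (𝐞 ((h' : ℝ) * α) : ℂ)) =
      ∑ h ∈ T, ∑ h' ∈ T, a h * b h' * (𝐞 ((((h' - h : ℤ)) : ℝ) * α) : ℂ) := by
    intro α
    rw [Finset.sum_mul_sum]
    refine Finset.sum_congr rfl fun h _ => Finset.sum_congr rfl fun h' _ => ?_
    rw [← fourierChar_neg_mul_mul]
    ring
  simp_rw [hexp]
  have horth : ∀ n : ℤ, ∫ α in (0 : ℝ)..1, (𝐞 (n * α) : ℂ) = if n = 0 then 1 else 0 :=
    integral_fourierChar_intCast_holds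
  have hint1 : ∀ h ∈ T, IntervalIntegrable (fun x : ℝ =>
      ∑ h' ∈ T, a h * b h' * (𝐞 ((((h' - h : ℤ)) : ℝ) * x) : ℂ)) volume 0 1 :=
    fun h _ => (continuous_finsetSum T fun h' _ =>
      continuous_const.mul (continuous_fourierChar_mul _)).intervalIntegrable 0 1
  have hint2 : ∀ h h' : ℤ, IntervalIntegrable (fun x : ℝ =>
      a h * b h' * (𝐞 ((((h' - h : ℤ)) : ℝ) * x) : ℂ)) volume 0 1 :=
    fun h h' => (continuous_const.mul (continuous_fourierChar_mul _)).intervalIntegrable 0 1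
  rw [intervalIntegral.integral_finsetSum hint1]
  refine Finset.sum_congr rfl fun h hh => ?_
  rw [intervalIntegral.integral_finsetSum fun h' _ => hint2 h h']
  simp_rw [intervalIntegral.integral_const_mul, horth, sub_eq_zero, mul_ite, mul_one, mul_zero]
  rw [Finset.sum_ite, Finset.sum_const_zero, add_zero]
  have : T.filter (fun h' => h' = h) = {h} := by
    ext h'
    simp only [Finset.mem_filter, Finset.mem_singleton]
    exact ⟨fun h1 => h1.2, fun h1 => ⟨h1 ▸ hh, h1⟩⟩
  rw [this, Finset.sum_singleton]

/-- Parseval for a natural-frequency trigonometric sum: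
`∫₀¹ ‖∑_{m ∈ s} c_m e(mα)‖² dα = ∑_{m ∈ s} ‖c_m‖²`. [folklore] -/
theorem integral_norm_sq_natTrigSum (s : Finset ℕ) (c : ℕ → ℂ) :
    ∫ α in (0 : ℝ)..1, ‖∑ m ∈ s, c m * (𝐞 ((m : ℝ) * α) : ℂ)‖ ^ 2 = ∑ m ∈ s, ‖c m‖ ^ 2 := by
  have h := integral_norm_sq_trigSum s c (fun m : ℕ => (m : ℤ)) (fun a _ b _ hab => by
    simpa using hab)
  simpa only [Int.cast_natCast] using h

/-! ### Window multiplicities -/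

/-- Each `m` lies in at most `L` of the windows `(k - L, k]`, `k ∈ [1, X + L]`: for `a ≥ 0`,
`∑_{k=1}^{X+L} ∑_{m ∈ (k-L, k]} a(m) ≤ L ∑_{m=1}^{X+L} a(m)`. [folklore] -/
theorem sum_window_sum_le (X L : ℕ) (a : ℕ → ℝ) (ha : ∀ n, 0 ≤ a n) :
    ∑ k ∈ Icc 1 (X + L), ∑ m ∈ Ioc (k - L) k, a m ≤ L * ∑ m ∈ Icc 1 (X + L), a m := by
  set f : ℕ → ℝ := fun n => if n ∈ Icc 1 (X + L) then a n else 0 with hf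
  have hfs : ∀ n, n ∉ Icc 1 (X + L) → f n = 0 := fun n hn => by simp only [hf]; rw [if_neg hn]
  have h0 := sum_window_shift (S := ℝ) (X + L) L 0 f (fun _ => 1) hfs
  simp only [add_zero, mul_one, Nat.sub_zero] at h0
  have hf_eq : ∑ n ∈ Icc 1 (X + L), f n = ∑ n ∈ Icc 1 (X + L), a n :=
    Finset.sum_congr rfl fun n hn => by simp only [hf]; rw [if_pos hn]
  rw [hf_eq] at h0
  rw [← h0]
  have hsub : Icc 1 (X + L) ⊆ Icc 1 (X + L + L) := by
    intro k hk; simp only [Finset.mem_Icc] at hk ⊢; omega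
  have hf0 : ∀ n, 0 ≤ f n := fun n => by
    simp only [hf]
    by_cases h : n ∈ Icc 1 (X + L)
    · rw [if_pos h]; exact ha n
    · rw [if_neg h]
  have hnn : ∀ k ∈ Icc 1 (X + L + L),
      0 ≤ ∑ n ∈ Ioc (k - L) k, (if n ∈ Ioc (k - L) k then f n else 0) := by
    intro k _
    refine Finset.sum_nonneg fun n _ => ?_
    by_cases h : n ∈ Ioc (k - L) k
    · rw [if_pos h]; exact hf0 n
    · rw [if_neg h]
  refine le_trans ?_ (Finset.sum_le_sum_of_subset_of_nonneg hsub fun k hk _ => hnn k hk)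
  refine Finset.sum_le_sum fun k hk => Finset.sum_le_sum fun n hn => ?_
  rw [if_pos hn]
  have hnI : n ∈ Icc 1 (X + L) := by
    simp only [Finset.mem_Icc, Finset.mem_Ioc] at hk hn ⊢; omega
  simp only [hf]; rw [if_pos hnI]

/-! ### Proposition 3.2 (discrete form) -/

set_option maxHeartbeats 400000 in
/-- **Lichtman–Teräväinen 2022, Proposition 3.2 (the Fourier-analytic argument), discrete form.**
Let `u, w : ℕ → ℂ` with `w` supported on `[1, X]`, `H ≥ 1`, `j ≥ 2`, windows `W_k = (k - 2H, k]`
for `k ∈ [1, X + 2H]`.  Assume the uniform `L²` bound (`𝖧₂`)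
`∑_k |∑_{m ∈ W_k} u(m) e(mα)|² ≤ A₂` for every real `α`, and the moment bound (`𝖧₁`)
`∫₀¹ ∑_k |∑_{n ∈ W_k} w(n) e(-nα)|^{2j} dα ≤ A₁`.  Then
`H · ∑_{h=1}^{H} |∑_{n=1}^{X} w(n) u(n+h)|
  ≤ A₂^{1/(2j)} · H^{1/2} · (2H ∑_{m=1}^{X+2H} |u(m)|²)^{(j-1)/(2j)} · ((X + 2H)^{j-1} A₁)^{1/(2j)}`.
(Printed: `∑_{h ≤ H} |∑_{n ≤ X} f(n+h) g(n)| ≪ (ηC)^{1/p} H X E_{|f|+|f|²}(X) E_g(X)` under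
`𝖧₂(X,H,η)` for `f` and `𝖧₁(X,H,C,p)` for `g`; here `f ↦ u`, `g ↦ w`, `p = 2j`, `η H² X E_f² ↦ A₂`,
`C H^{p-1} X E_g^p ↦ A₁`, and the `x`-integral is the sum over integer windows.)
[cite: LichtmanTeravainen2022, Proposition 3.2] -/
theorem holder_fourier_bound (X H j : ℕ) (hH : 1 ≤ H) (hj : 2 ≤ j) (u w : ℕ → ℂ)
    (hw : ∀ n, n ∉ Icc 1 X → w n = 0) {A₁ A₂ : ℝ}
    (hA₂ : ∀ α : ℝ, ∑ k ∈ Icc 1 (X + 2 * H),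
      ‖∑ m ∈ Ioc (k - 2 * H) k, u m * (𝐞 ((m : ℝ) * α) : ℂ)‖ ^ 2 ≤ A₂)
    (hA₁ : ∫ α in (0 : ℝ)..1, ∑ k ∈ Icc 1 (X + 2 * H),
      ‖∑ n ∈ Ioc (k - 2 * H) k, w n * (𝐞 (-((n : ℝ) * α)) : ℂ)‖ ^ (2 * j) ≤ A₁) :
    (H : ℝ) * ∑ h ∈ Icc 1 H, ‖∑ n ∈ Icc 1 X, w n * u (n + h)‖ ≤
      A₂ ^ (1 / (2 * j) : ℝ) * (H : ℝ) ^ (1 / 2 : ℝ) *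
        ((2 * H : ℝ) * ∑ m ∈ Icc 1 (X + 2 * H), ‖u m‖ ^ 2) ^ (((j : ℝ) - 1) / (2 * j)) *
        (((X + 2 * H : ℕ) : ℝ) ^ (j - 1) * A₁) ^ (1 / (2 * j) : ℝ) := by
  -- notation
  set L : ℕ := 2 * H with hL
  set K : Finset ℕ := Icc 1 (X + L) with hK
  set T : Finset ℤ := Icc (-((X + L : ℕ) : ℤ)) ((X + L : ℕ) : ℤ) with hT
  set Cf : ℕ → ℤ → ℂ := fun k h =>
    ∑ n ∈ Ioc (k - L) k, ∑ m ∈ Ioc (k - L) k, if (m : ℤ) - n = h then w n * u m else 0 with hCf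
  set U : ℕ → ℝ → ℂ := fun k α => ∑ m ∈ Ioc (k - L) k, u m * (𝐞 ((m : ℝ) * α) : ℂ) with hU
  set W : ℕ → ℝ → ℂ := fun k α =>
    ∑ n ∈ Ioc (k - L) k, w n * (𝐞 ((((-(n : ℤ) : ℤ)) : ℝ) * α) : ℂ) with hW
  set z : ℤ → ℂ := fun h => ∑ k ∈ K, Cf k h with hz
  set Sset : Finset ℤ := (Icc 1 H).image (fun h : ℕ => (h : ℤ)) with hSset
  set c : ℤ → ℂ := fun h => if h ∈ Sset then conj (z h) / (‖z h‖ : ℂ) else 0 with hc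
  set C₀ : ℝ → ℂ := fun α => ∑ h ∈ T, c h * (𝐞 ((((-h : ℤ)) : ℝ) * α) : ℂ) with hC₀
  set Φ : ℝ → ℝ := fun α => ∑ k ∈ K, ‖U k α‖ ^ 2 with hΦ
  set Ψ : ℝ → ℝ := fun α => ∑ k ∈ K, ‖W k α‖ ^ 2 with hΨ
  set Bu : ℝ := ∑ m ∈ Icc 1 (X + L), ‖u m‖ ^ 2 with hBu
  set Ssum : ℝ := ∑ h ∈ Icc 1 H, ‖∑ n ∈ Icc 1 X, w n * u (n + h)‖ with hSsum
  -- real parameters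
  have hj1 : (1 : ℝ) < j := by exact_mod_cast (show 1 < j by omega)
  have hj0 : (0 : ℝ) < j := by linarith
  set e : ℝ := 1 / (2 * j) with he
  set θ : ℝ := ((j : ℝ) - 1) / (2 * j) with hθ
  set θ' : ℝ := ((j : ℝ) - 1) / j with hθ'
  set r : ℝ := (j : ℝ) / ((j : ℝ) - 1) with hr
  have he0 : 0 < e := by rw [he]; positivity
  have hθ0 : 0 < θ := by rw [hθ]; exact div_pos (by linarith) (by positivity)
  have hθ'0 : 0 < θ' := by rw [hθ']; exact div_pos (by linarith) hj0
  have hjm1 : (j : ℝ) - 1 ≠ 0 := (by linarith : (0 : ℝ) < j - 1).ne'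
  have heθ : e + θ = 1 / 2 := by rw [he, hθ]; field_simp; ring
  have hθ2 : θ * 2 = θ' := by rw [hθ, hθ']; field_simp
  have hθ'r : θ' * r = 1 := by
    rw [hθ', hr]; field_simp
  have hrj : r.HolderConjugate (j : ℝ) := by
    rw [Real.holderConjugate_iff]
    refine ⟨?_, ?_⟩
    · rw [hr, lt_div_iff₀ (by linarith)]; linarith
    · rw [hr]; field_simp; ring
  have hr0 : 0 < r := hrj.pos
  have h1r : 1 / r = θ' := by rw [hr, hθ']; field_simp
  -- the hypothesis `hA₁` in the `W`-notation
  have hWeq : ∀ k α, ∑ n ∈ Ioc (k - 2 * H) k, w n * (𝐞 (-((n : ℝ) * α)) : ℂ) = W k α := by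
    intro k α
    refine Finset.sum_congr rfl fun n _ => ?_
    congr 3
    push_cast
    ring
  have hA₁' : ∫ α in (0 : ℝ)..1, ∑ k ∈ K, ‖W k α‖ ^ (2 * j) ≤ A₁ := by
    have : (fun α => ∑ k ∈ K, ‖W k α‖ ^ (2 * j)) =
        fun α => ∑ k ∈ Icc 1 (X + 2 * H),
          ‖∑ n ∈ Ioc (k - 2 * H) k, w n * (𝐞 (-((n : ℝ) * α)) : ℂ)‖ ^ (2 * j) := by
      funext α
      exact Finset.sum_congr rfl fun k _ => by rw [hWeq]
    rw [this]
    exact hA₁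
  have hA₂' : ∀ α, Φ α ≤ A₂ := fun α => hA₂ α
  -- basic nonnegativity
  have hΦ0 : ∀ α, 0 ≤ Φ α := fun α => Finset.sum_nonneg fun k _ => by positivity
  have hΨ0 : ∀ α, 0 ≤ Ψ α := fun α => Finset.sum_nonneg fun k _ => by positivity
  have hA₂0 : 0 ≤ A₂ := (hΦ0 0).trans (hA₂' 0)
  have hBu0 : 0 ≤ Bu := Finset.sum_nonneg fun m _ => by positivity
  -- continuity
  have hUc : ∀ k, Continuous (U k) := fun k =>
    continuous_finsetSum _ fun m _ => continuous_const.mul (continuous_fourierChar_mul _)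
  have hWc : ∀ k, Continuous (W k) := fun k =>
    continuous_finsetSum _ fun n _ => continuous_const.mul (continuous_fourierChar_mul _)
  have hC₀c : Continuous C₀ :=
    continuous_finsetSum _ fun h _ => continuous_const.mul (continuous_fourierChar_mul _)
  have hΦc : Continuous Φ := continuous_finsetSum _ fun k _ => ((hUc k).norm).pow 2
  have hΨc : Continuous Ψ := continuous_finsetSum _ fun k _ => ((hWc k).norm).pow 2
  -- Step A: double counting `(L - h) S_h = z h`
  have hA : ∀ h : ℕ, ((L - h : ℕ) : ℂ) * ∑ n ∈ Icc 1 X, w n * u (n + h) = z h := by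
    intro h
    have h1 := sum_window_shift X L h w u hw
    rw [← h1]
    refine Finset.sum_congr rfl fun k _ => Finset.sum_congr rfl fun n _ => ?_
    have : ∀ m : ℕ, ((m : ℤ) - n = (h : ℕ)) ↔ (n + h = m) := fun m => by omega
    simp_rw [this, Finset.sum_ite_eq]
  -- Step B: `H · Ssum ≤ Σ := ∑_{h ≤ H} ‖z h‖`
  have hB : (H : ℝ) * Ssum ≤ ∑ h ∈ Icc 1 H, ‖z (h : ℤ)‖ := by
    rw [hSsum, Finset.mul_sum]
    refine Finset.sum_le_sum fun h hh => ?_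
    rw [Finset.mem_Icc] at hh
    rw [← hA h, norm_mul, Complex.norm_natCast]
    refine mul_le_mul_of_nonneg_right ?_ (norm_nonneg _)
    exact_mod_cast (by omega : H ≤ L - h)
  -- Step C: the phases
  have hSsetT : Sset ⊆ T := by
    intro x hx
    simp only [hSset, Finset.mem_image, Finset.mem_Icc] at hx
    obtain ⟨h, hh, rfl⟩ := hx
    simp only [hT, Finset.mem_Icc]
    omega
  have hc1 : ∀ h, ‖c h‖ ≤ 1 := by
    intro h
    simp only [hc]
    split_ifs
    · rw [norm_div, Complex.norm_conj, Complex.norm_real, Real.norm_eq_abs, abs_norm]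
      exact div_self_le_one _
    · simp
  have hc0 : ∀ h, h ∉ Sset → c h = 0 := fun h hh => by simp only [hc]; rw [if_neg hh]
  have hcz : ∀ h ∈ Sset, c h * z h = (‖z h‖ : ℂ) := by
    intro h hh
    simp only [hc]
    rw [if_pos hh]
    by_cases hz0 : z h = 0
    · rw [hz0]; simp
    · have hn : (‖z h‖ : ℂ) ≠ 0 := by
        rw [Ne, Complex.ofReal_eq_zero, norm_eq_zero]; exact hz0
      rw [div_mul_eq_mul_div, Complex.conj_mul', div_eq_iff hn]
      ring
  have hSigEq : ((∑ h ∈ Icc 1 H, ‖z (h : ℤ)‖ : ℝ) : ℂ) = ∑ h ∈ T, c h * z h := by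
    have h1 : ∑ h ∈ T, c h * z h = ∑ h ∈ Sset, c h * z h := by
      symm
      refine Finset.sum_subset hSsetT fun h _ hh => ?_
      rw [hc0 h hh, zero_mul]
    rw [h1, Finset.sum_congr rfl hcz, Complex.ofReal_sum, hSset,
      Finset.sum_image fun a _ b _ hab => by exact_mod_cast hab]
  -- Step D: Fourier identity `∑_{h ∈ T} c h · Cf k h = ∫₀¹ C₀ U_k W_k`
  have hTmem : ∀ k ∈ K, ∀ n ∈ Ioc (k - L) k, ∀ m ∈ Ioc (k - L) k, (m : ℤ) - n ∈ T := by
    intro k hk n hn m hm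
    simp only [hK, hT, Finset.mem_Icc, Finset.mem_Ioc] at hk hn hm ⊢
    omega
  have hD : ∀ k ∈ K, ∑ h ∈ T, c h * Cf k h =
      ∫ α in (0 : ℝ)..1, C₀ α * (U k α * W k α) := by
    intro k hk
    have h1 : ∀ α, U k α * W k α = ∑ h' ∈ T, Cf k h' * (𝐞 ((h' : ℝ) * α) : ℂ) := fun α =>
      (sum_coeff_fourierChar_eq (Ioc (k - L) k) w u T (hTmem k hk) α).symm
    simp_rw [h1]
    exact (integral_trigSum_mul_trigSum T c (Cf k)).symm
  -- Step E: `Σ = ∫₀¹ C₀ ∑_k U_k W_k`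
  have hprodc : ∀ k, Continuous fun α => C₀ α * (U k α * W k α) := fun k =>
    hC₀c.mul ((hUc k).mul (hWc k))
  have hE : ∑ h ∈ T, c h * z h = ∫ α in (0 : ℝ)..1, C₀ α * ∑ k ∈ K, U k α * W k α := by
    have h1 : ∑ h ∈ T, c h * z h = ∑ k ∈ K, ∑ h ∈ T, c h * Cf k h := by
      simp only [hz, Finset.mul_sum]
      rw [Finset.sum_comm]
    rw [h1, Finset.sum_congr rfl hD, ← intervalIntegral.integral_finsetSum fun k _ =>
      (hprodc k).intervalIntegrable 0 1]
    refine intervalIntegral.integral_congr fun α _ => ?_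
    simp only [Finset.mul_sum]
  -- Step F: `Σ ≤ ∫₀¹ ‖C₀‖ ∑_k ‖U_k‖ ‖W_k‖`
  set gα : ℝ → ℝ := fun α => ∑ k ∈ K, ‖U k α‖ * ‖W k α‖ with hgα
  have hgαc : Continuous gα := continuous_finsetSum _ fun k _ => ((hUc k).norm).mul (hWc k).norm
  have hgα0 : ∀ α, 0 ≤ gα α := fun α => Finset.sum_nonneg fun k _ => by positivity
  have hF : ∑ h ∈ Icc 1 H, ‖z (h : ℤ)‖ ≤ ∫ α in (0 : ℝ)..1, ‖C₀ α‖ * gα α := by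
    have h1 : (∑ h ∈ Icc 1 H, ‖z (h : ℤ)‖ : ℝ) =
        ‖∫ α in (0 : ℝ)..1, C₀ α * ∑ k ∈ K, U k α * W k α‖ := by
      rw [← hE, ← hSigEq, Complex.norm_real, Real.norm_eq_abs, abs_of_nonneg]
      exact Finset.sum_nonneg fun h _ => norm_nonneg _
    rw [h1]
    refine (intervalIntegral.norm_integral_le_integral_norm zero_le_one).trans ?_
    refine intervalIntegral.integral_mono_on zero_le_one ?_ ?_ fun α _ => ?_
    · exact ((hC₀c.mul (continuous_finsetSum _ fun k _ => (hUc k).mul (hWc k))).norm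
        ).intervalIntegrable 0 1
    · exact (hC₀c.norm.mul hgαc).intervalIntegrable 0 1
    · rw [norm_mul]
      refine mul_le_mul_of_nonneg_left ?_ (norm_nonneg _)
      refine (norm_sum_le _ _).trans ?_
      exact le_of_eq (Finset.sum_congr rfl fun k _ => norm_mul _ _)
  -- Step G: pointwise `gα ≤ A₂^e Φ^θ Ψ^{1/2}`
  have hG : ∀ α, gα α ≤ A₂ ^ e * (Φ α ^ θ * Ψ α ^ (1 / 2 : ℝ)) := by
    intro α
    have hCS : gα α ≤ Real.sqrt (Φ α) * Real.sqrt (Ψ α) := by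
      have h2 := Finset.sum_mul_sq_le_sq_mul_sq K (fun k => ‖U k α‖) (fun k => ‖W k α‖)
      rw [← Real.sqrt_mul (hΦ0 α), ← Real.sqrt_sq (hgα0 α)]
      exact Real.sqrt_le_sqrt h2
    have hsΦ : Real.sqrt (Φ α) = Φ α ^ e * Φ α ^ θ := by
      rw [Real.sqrt_eq_rpow, ← Real.rpow_add' (hΦ0 α) (by rw [heθ]; norm_num), heθ]
    have hsΨ : Real.sqrt (Ψ α) = Ψ α ^ (1 / 2 : ℝ) := Real.sqrt_eq_rpow _
    have hΦe : Φ α ^ e ≤ A₂ ^ e := Real.rpow_le_rpow (hΦ0 α) (hA₂' α) he0.le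
    calc gα α ≤ Real.sqrt (Φ α) * Real.sqrt (Ψ α) := hCS
      _ = Φ α ^ e * (Φ α ^ θ * Ψ α ^ (1 / 2 : ℝ)) := by rw [hsΦ, hsΨ]; ring
      _ ≤ A₂ ^ e * (Φ α ^ θ * Ψ α ^ (1 / 2 : ℝ)) := by
        refine mul_le_mul_of_nonneg_right hΦe ?_
        exact mul_nonneg (Real.rpow_nonneg (hΦ0 α) _) (Real.rpow_nonneg (hΨ0 α) _)
  -- Step H: Hölder number one (Cauchy–Schwarz in `α`)
  set G₂ : ℝ → ℝ := fun α => Φ α ^ θ * Ψ α ^ (1 / 2 : ℝ) with hG₂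
  have hG₂c : Continuous G₂ :=
    (hΦc.rpow_const fun α => Or.inr hθ0.le).mul (hΨc.rpow_const fun α => Or.inr (by norm_num))
  have hG₂0 : ∀ α, 0 ≤ G₂ α := fun α =>
    mul_nonneg (Real.rpow_nonneg (hΦ0 α) _) (Real.rpow_nonneg (hΨ0 α) _)
  have hH1 : ∫ α in (0 : ℝ)..1, ‖C₀ α‖ * gα α ≤
      A₂ ^ e * ((∫ α in (0 : ℝ)..1, ‖C₀ α‖ ^ 2) ^ (1 / 2 : ℝ) *
        (∫ α in (0 : ℝ)..1, G₂ α ^ 2) ^ (1 / 2 : ℝ)) := by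
    have h1 : ∫ α in (0 : ℝ)..1, ‖C₀ α‖ * gα α ≤ ∫ α in (0 : ℝ)..1, A₂ ^ e * (‖C₀ α‖ * G₂ α) := by
      refine intervalIntegral.integral_mono_on zero_le_one
        ((hC₀c.norm.mul hgαc).intervalIntegrable 0 1)
        ((continuous_const.mul (hC₀c.norm.mul hG₂c)).intervalIntegrable 0 1) fun α _ => ?_
      calc ‖C₀ α‖ * gα α ≤ ‖C₀ α‖ * (A₂ ^ e * G₂ α) :=
            mul_le_mul_of_nonneg_left (hG α) (norm_nonneg _)
        _ = A₂ ^ e * (‖C₀ α‖ * G₂ α) := by ring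
    refine h1.trans ?_
    rw [intervalIntegral.integral_const_mul]
    refine mul_le_mul_of_nonneg_left ?_ (Real.rpow_nonneg hA₂0 _)
    have h2 := holder_unitInterval Real.HolderConjugate.two_two hC₀c.norm hG₂c
      (fun α => norm_nonneg _) hG₂0
    simpa only [Real.rpow_two] using h2
  -- Step I: `∫ ‖C₀‖² ≤ H`
  have hI : ∫ α in (0 : ℝ)..1, ‖C₀ α‖ ^ 2 ≤ H := by
    have h1 := integral_norm_sq_trigSum T c (fun h : ℤ => -h) (fun a _ b _ hab => neg_injective hab)
    have h1' : ∫ α in (0 : ℝ)..1, ‖C₀ α‖ ^ 2 = ∑ h ∈ T, ‖c h‖ ^ 2 := by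
      rw [← h1]
    rw [h1']
    have h2 : ∑ h ∈ T, ‖c h‖ ^ 2 = ∑ h ∈ Sset, ‖c h‖ ^ 2 := by
      symm
      refine Finset.sum_subset hSsetT fun h _ hh => ?_
      rw [hc0 h hh]; simp
    rw [h2]
    calc ∑ h ∈ Sset, ‖c h‖ ^ 2 ≤ ∑ h ∈ Sset, (1 : ℝ) := Finset.sum_le_sum fun h _ => by
          have := hc1 h
          have h0 : 0 ≤ ‖c h‖ := norm_nonneg _
          nlinarith
      _ = #Sset := by simp
      _ ≤ H := by
        rw [hSset, Finset.card_image_of_injective _ fun a b hab => by exact_mod_cast hab]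
        simp
  -- Step J: `∫ G₂² ≤ (∫ Φ)^{1/r} (∫ Ψ^j)^{1/j}` (Hölder number two)
  have hG₂sq : ∀ α, G₂ α ^ 2 = Φ α ^ θ' * Ψ α := by
    intro α
    simp only [hG₂]
    rw [mul_pow, ← Real.rpow_natCast (Φ α ^ θ) 2, ← Real.rpow_mul (hΦ0 α),
      ← Real.rpow_natCast (Ψ α ^ (1 / 2 : ℝ)) 2, ← Real.rpow_mul (hΨ0 α),
      show θ * ((2 : ℕ) : ℝ) = θ' by rw [← hθ2]; norm_num,
      show (1 / 2 : ℝ) * ((2 : ℕ) : ℝ) = 1 by norm_num, Real.rpow_one]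
  have hJ : ∫ α in (0 : ℝ)..1, G₂ α ^ 2 ≤
      (∫ α in (0 : ℝ)..1, Φ α) ^ (1 / r) * (∫ α in (0 : ℝ)..1, Ψ α ^ (j : ℝ)) ^ (1 / (j : ℝ)) := by
    simp_rw [hG₂sq]
    have h1 := holder_unitInterval hrj (hΦc.rpow_const fun α => Or.inr hθ'0.le) hΨc
      (fun α => Real.rpow_nonneg (hΦ0 α) _) hΨ0
    have h2 : ∀ α, (Φ α ^ θ') ^ r = Φ α := fun α => by
      rw [← Real.rpow_mul (hΦ0 α), hθ'r, Real.rpow_one]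
    simp_rw [h2] at h1
    exact h1
  -- Step K: `∫ Φ ≤ L · Bu`
  have hKΦ : ∫ α in (0 : ℝ)..1, Φ α ≤ L * Bu := by
    have h1 : ∫ α in (0 : ℝ)..1, Φ α = ∑ k ∈ K, ∑ m ∈ Ioc (k - L) k, ‖u m‖ ^ 2 := by
      simp only [hΦ]
      rw [intervalIntegral.integral_finsetSum]
      · exact Finset.sum_congr rfl fun k _ => integral_norm_sq_natTrigSum _ u
      · intro k _
        exact (((hUc k).norm).pow 2).intervalIntegrable 0 1
    rw [h1]
    exact sum_window_sum_le X L (fun m => ‖u m‖ ^ 2) fun m => by positivity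
  -- Step L: `∫ Ψ^j ≤ #K^{j-1} A₁`
  have hLΨ : ∫ α in (0 : ℝ)..1, Ψ α ^ (j : ℝ) ≤ ((X + L : ℕ) : ℝ) ^ (j - 1) * A₁ := by
    have hcard : (#K : ℝ) = ((X + L : ℕ) : ℝ) := by simp [hK]
    have hpt : ∀ α, Ψ α ^ (j : ℝ) ≤ ((X + L : ℕ) : ℝ) ^ (j - 1) * ∑ k ∈ K, ‖W k α‖ ^ (2 * j) := by
      intro α
      rw [Real.rpow_natCast]
      have h1 := pow_sum_le_card_mul_sum_pow (s := K) (f := fun k => ‖W k α‖ ^ 2)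
        (fun k _ => by positivity) (j - 1)
      have hj' : j - 1 + 1 = j := by omega
      rw [hj'] at h1
      simp only [hΨ]
      refine h1.trans (le_of_eq ?_)
      rw [hcard]
      congr 1
      exact Finset.sum_congr rfl fun k _ => by rw [← pow_mul]
    calc ∫ α in (0 : ℝ)..1, Ψ α ^ (j : ℝ)
        ≤ ∫ α in (0 : ℝ)..1, ((X + L : ℕ) : ℝ) ^ (j - 1) * ∑ k ∈ K, ‖W k α‖ ^ (2 * j) := by
          refine intervalIntegral.integral_mono_on zero_le_one
            ((hΨc.rpow_const fun α => Or.inr hj0.le).intervalIntegrable 0 1)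
            ((continuous_const.mul (continuous_finsetSum _ fun k _ =>
              ((hWc k).norm).pow _)).intervalIntegrable 0 1) fun α _ => hpt α
      _ = ((X + L : ℕ) : ℝ) ^ (j - 1) * ∫ α in (0 : ℝ)..1, ∑ k ∈ K, ‖W k α‖ ^ (2 * j) := by
          rw [intervalIntegral.integral_const_mul]
      _ ≤ ((X + L : ℕ) : ℝ) ^ (j - 1) * A₁ :=
          mul_le_mul_of_nonneg_left hA₁' (by positivity)
  -- nonnegativity of the integrals involved
  have hintΦ0 : 0 ≤ ∫ α in (0 : ℝ)..1, Φ α :=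
    intervalIntegral.integral_nonneg zero_le_one fun α _ => hΦ0 α
  have hintΨ0 : 0 ≤ ∫ α in (0 : ℝ)..1, Ψ α ^ (j : ℝ) :=
    intervalIntegral.integral_nonneg zero_le_one fun α _ => Real.rpow_nonneg (hΨ0 α) _
  have hintC0 : 0 ≤ ∫ α in (0 : ℝ)..1, ‖C₀ α‖ ^ 2 :=
    intervalIntegral.integral_nonneg zero_le_one fun α _ => by positivity
  have hintG0 : 0 ≤ ∫ α in (0 : ℝ)..1, G₂ α ^ 2 :=
    intervalIntegral.integral_nonneg zero_le_one fun α _ => by positivity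
  have hA₁0 : 0 ≤ A₁ := le_trans (intervalIntegral.integral_nonneg zero_le_one fun α _ =>
    Finset.sum_nonneg fun k _ => by positivity) hA₁'
  -- Step M: assemble
  have hM1 : (∫ α in (0 : ℝ)..1, ‖C₀ α‖ ^ 2) ^ (1 / 2 : ℝ) ≤ (H : ℝ) ^ (1 / 2 : ℝ) :=
    Real.rpow_le_rpow hintC0 hI (by norm_num)
  have hM2 : (∫ α in (0 : ℝ)..1, G₂ α ^ 2) ^ (1 / 2 : ℝ) ≤
      ((L * Bu) ^ θ' * ((((X + L : ℕ) : ℝ) ^ (j - 1) * A₁) ^ (1 / (j : ℝ)))) ^ (1 / 2 : ℝ) := by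
    refine Real.rpow_le_rpow hintG0 (hJ.trans ?_) (by norm_num)
    rw [h1r]
    refine mul_le_mul (Real.rpow_le_rpow hintΦ0 hKΦ hθ'0.le)
      (Real.rpow_le_rpow hintΨ0 hLΨ (by positivity)) (Real.rpow_nonneg hintΨ0 _)
      (Real.rpow_nonneg (by positivity) _)
  have hM3 : ((L * Bu) ^ θ' * ((((X + L : ℕ) : ℝ) ^ (j - 1) * A₁) ^ (1 / (j : ℝ)))) ^ (1 / 2 : ℝ)
      = (L * Bu) ^ θ * (((X + L : ℕ) : ℝ) ^ (j - 1) * A₁) ^ e := by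
    rw [Real.mul_rpow (Real.rpow_nonneg (by positivity) _) (Real.rpow_nonneg (by positivity) _),
      ← Real.rpow_mul (by positivity), ← Real.rpow_mul (by positivity)]
    congr 2
    · rw [← hθ2]; ring
    · rw [he]; field_simp
  have hfinal : (H : ℝ) * Ssum ≤
      A₂ ^ e * ((H : ℝ) ^ (1 / 2 : ℝ) * ((L * Bu) ^ θ * (((X + L : ℕ) : ℝ) ^ (j - 1) * A₁) ^ e)) := by
    refine hB.trans (hF.trans (hH1.trans ?_))
    refine mul_le_mul_of_nonneg_left ?_ (Real.rpow_nonneg hA₂0 _)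
    rw [← hM3]
    exact mul_le_mul hM1 hM2 (Real.rpow_nonneg hintG0 _) (Real.rpow_nonneg (by positivity) _)
  -- rewrite in the statement's notation
  have hLr : ((L : ℕ) : ℝ) = 2 * H := by rw [hL]; push_cast; ring
  calc (H : ℝ) * ∑ h ∈ Icc 1 H, ‖∑ n ∈ Icc 1 X, w n * u (n + h)‖ = (H : ℝ) * Ssum := rfl
    _ ≤ A₂ ^ e * ((H : ℝ) ^ (1 / 2 : ℝ) *
          ((L * Bu) ^ θ * (((X + L : ℕ) : ℝ) ^ (j - 1) * A₁) ^ e)) := hfinal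
    _ = A₂ ^ (1 / (2 * j) : ℝ) * (H : ℝ) ^ (1 / 2 : ℝ) *
        ((2 * H : ℝ) * ∑ m ∈ Icc 1 (X + 2 * H), ‖u m‖ ^ 2) ^ (((j : ℝ) - 1) / (2 * j)) *
        (((X + 2 * H : ℕ) : ℝ) ^ (j - 1) * A₁) ^ (1 / (2 * j) : ℝ) := by
          rw [he, hθ, hBu, hLr]
          ring

end Literature.NumberTheory.Sieve.LichtmanTeravainen2022
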